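import Mathlib.Algebra.MvPolynomial.CommRing
import Mathlib.Algebra.MvPolynomial.Eval
import HarnessLib

/-!
# A linear form in the variables with a regular coefficient is a non-zero-divisor (siege k11, crux `ApproximationProperty`)

Crux `stmt-Schanuel-6117` (`Summit.Schanuel.Schanuel.Theses.DiophantineDichotomy.ApproximationProperty`),
line `orbit-interpolation-determinant`, stub `CycleAPIAt3` (variation "Chardin Hilbert-function bound").
Helper file 1/5 of the lower bound for the Hilbert function of a prime space curve lying on a
complete intersection (`…CurveHilbertLowerBoundK11.lean`): the regularity of the GENERIC linear
form. Everything here is PROVED; no definitions, no named facts.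

For a commutative ring `T` and the polynomial ring `T[u]` (`MvPolynomial U T`), with the linear form
`ℓ_c = ∑ᵤ Xᵤ · cᵤ` (`c : U → T`):

* `linForm_mul_eq_zero` — if ONE coefficient `c_{u₀}` is a non-zero-divisor of `T`, then `ℓ_c` is a
  non-zero-divisor of `T[u]` (compare the coefficient at `α + e_{u₀}` for `α` on the support
  maximising the exponent of `u₀`, `coeff_linForm_mul_of_max`);
* `linForm_mul_eq_zero_of_combination` — the same when a combination `∑ nᵤ cᵤ` with `n_{u₀} = 1`
  is a non-zero-divisor (after the invertible substitution `Xᵤ ↦ Xᵤ + nᵤ X_{u₀}`, `u ≠ u₀`);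
* `C_mul_eq_zero` — constants with regular value are non-zero-divisors.

Used in `…GenericRegularityK11.lean` for the generic hyperplane `∑ₖ u_k x_k` modulo an extended
ideal. Source of the method: M. Chardin, Bull. SMF 117 (1989) (generic linear sections); the algebra
is [folklore].
-/

set_option linter.dupNamespace false

noncomputable section

namespace Summit.Schanuel.Schanuel.Cruxes.ApproximationProperty.OrbitInterpolationDeterminant

namespace GenericRegularityK11

open MvPolynomial

variable {T : Type} [CommRing T] {U : Type}

/-- A constant with regular value is a non-zero-divisor of `T[u]`. [folklore] -/
theorem C_mul_eq_zero {t : T} (hreg : ∀ s : T, t * s = 0 → s = 0) {F : MvPolynomial U T}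
    (hF : C t * F = 0) : F = 0 := by
  ext α
  have := congrArg (coeff α) hF
  rw [coeff_C_mul, coeff_zero] at this
  rw [coeff_zero]
  exact hreg _ this

variable [Fintype U]

/-- Coefficient of `ℓ_c · F` at `α + e_{u₀}` when `α` maximises the exponent of `u₀` on the support
of `F`: only the term `u = u₀` survives. [folklore] -/
theorem coeff_linForm_mul_of_max (c : U → T) (u₀ : U) {F : MvPolynomial U T} {α : U →₀ ℕ}
    (hmax : ∀ α' ∈ F.support, α' u₀ ≤ α u₀) :
    coeff (α + Finsupp.single u₀ 1) ((∑ u, X u * C (c u)) * F) = c u₀ * coeff α F := by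
  classical
  rw [Finset.sum_mul, coeff_sum]
  have hterm : ∀ u, coeff (α + Finsupp.single u₀ 1) (X u * C (c u) * F) =
      if u = u₀ then c u₀ * coeff α F else 0 := by
    intro u
    rw [mul_assoc, coeff_X_mul']
    by_cases hu : u = u₀
    · subst hu
      rw [if_pos (by simp), if_pos rfl, add_tsub_cancel_right, coeff_C_mul]
    · rw [if_neg hu]
      split_ifs with hmem
      · rw [coeff_C_mul]
        -- the shifted exponent has a larger `u₀`-coordinate, hence is off the support
        set γ := α + Finsupp.single u₀ 1 - Finsupp.single u 1 with hγ
        have hγu₀ : γ u₀ = α u₀ + 1 := by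
          rw [hγ, Finsupp.tsub_apply, Finsupp.add_apply, Finsupp.single_apply, if_pos rfl,
            Finsupp.single_apply, if_neg hu]
          omega
        have hnot : γ ∉ F.support := fun hγs => by
          have := hmax γ hγs
          omega
        rw [notMem_support_iff.mp hnot, mul_zero]
      · rfl
  simp_rw [hterm]
  rw [Finset.sum_ite_eq' Finset.univ u₀, if_pos (Finset.mem_univ _)]

/-- **A linear form with a regular coefficient is a non-zero-divisor**: if `c_{u₀}` is a
non-zero-divisor of `T` then `ℓ_c · F = 0` forces `F = 0` in `T[u]` (look at the largest
exponent of `u₀` on the support of `F`). [folklore] -/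
theorem linForm_mul_eq_zero (c : U → T) (u₀ : U) (hreg : ∀ t : T, c u₀ * t = 0 → t = 0)
    {F : MvPolynomial U T} (hF : (∑ u, X u * C (c u)) * F = 0) : F = 0 := by
  classical
  by_contra hF0
  have hne : F.support.Nonempty := by
    rw [Finset.nonempty_iff_ne_empty, Ne, support_eq_empty]
    exact hF0
  obtain ⟨α, hα, hmax⟩ := Finset.exists_max_image F.support (fun α => α u₀) hne
  have h := coeff_linForm_mul_of_max c u₀ (F := F) hmax
  rw [hF, coeff_zero] at h
  exact (mem_support_iff.mp hα) (hreg _ h.symm)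

/-- **A linear form one of whose coefficient-combinations is regular is a non-zero-divisor**: if
`n_{u₀} = 1` and `∑ nᵤ cᵤ` is a non-zero-divisor of `T`, then `ℓ_c · F = 0` forces `F = 0`
(the substitution `θ : Xᵤ ↦ Xᵤ + nᵤ X_{u₀}` (`u ≠ u₀`), which has the left inverse
`Xᵤ ↦ Xᵤ − nᵤ X_{u₀}`, maps `ℓ_c` to a linear form whose `u₀`-coefficient is `∑ nᵤ cᵤ`).
[folklore] -/
theorem linForm_mul_eq_zero_of_combination (c n : U → T) (u₀ : U) (hn : n u₀ = 1)
    (hreg : ∀ t : T, (∑ u, n u * c u) * t = 0 → t = 0)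
    {F : MvPolynomial U T} (hF : (∑ u, X u * C (c u)) * F = 0) : F = 0 := by
  classical
  -- the shear and its left inverse
  set θ : MvPolynomial U T →ₐ[T] MvPolynomial U T :=
    aeval fun u => if u = u₀ then X u₀ else X u + C (n u) * X u₀ with hθ
  set θ' : MvPolynomial U T →ₐ[T] MvPolynomial U T :=
    aeval fun u => if u = u₀ then X u₀ else X u - C (n u) * X u₀ with hθ'
  have hinv : θ'.comp θ = AlgHom.id T _ := by
    refine algHom_ext fun u => ?_
    rw [AlgHom.comp_apply, AlgHom.id_apply, hθ, aeval_X]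
    by_cases hu : u = u₀
    · subst hu
      rw [if_pos rfl, hθ', aeval_X, if_pos rfl]
    · rw [if_neg hu, map_add, map_mul, algHom_C, MvPolynomial.algebraMap_eq, hθ', aeval_X,
        aeval_X, if_neg hu, if_pos rfl]
      ring
  have hinj : Function.Injective θ := fun G₁ G₂ h => by
    have := congrArg θ' h
    rwa [← AlgHom.comp_apply, ← AlgHom.comp_apply, hinv, AlgHom.id_apply, AlgHom.id_apply] at this
  -- the image of the linear form
  set c' : U → T := Function.update c u₀ (∑ u, n u * c u) with hc'
  have himage : θ (∑ u, X u * C (c u)) = ∑ u, X u * C (c' u) := by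
    rw [map_sum]
    have hterm : ∀ u, θ (X u * C (c u)) =
        X u * C (if u = u₀ then 0 else c u) + X u₀ * C (n u * c u) := by
      intro u
      rw [map_mul, algHom_C, MvPolynomial.algebraMap_eq, hθ, aeval_X]
      by_cases hu : u = u₀
      · subst hu
        rw [if_pos rfl, if_pos rfl, hn, one_mul, C_0, mul_zero, zero_add]
      · rw [if_neg hu, if_neg hu, map_mul]
        ring
    simp_rw [hterm]
    rw [Finset.sum_add_distrib, ← Finset.mul_sum, ← map_sum]
    rw [← Finset.sum_erase_add Finset.univ _ (Finset.mem_univ u₀),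
      ← Finset.sum_erase_add Finset.univ (fun u => X u * C (c' u)) (Finset.mem_univ u₀)]
    rw [if_pos rfl, C_0, mul_zero, add_zero, hc', Function.update_self]
    congr 1
    refine Finset.sum_congr rfl fun u hu => ?_
    rw [Finset.mem_erase] at hu
    rw [if_neg hu.1, Function.update_of_ne hu.1]
  -- transport
  apply hinj
  rw [map_zero]
  have h : θ (∑ u, X u * C (c u)) * θ F = 0 := by rw [← map_mul, hF, map_zero]
  rw [himage] at h
  refine linForm_mul_eq_zero c' u₀ (fun t ht => hreg t ?_) h
  rwa [hc', Function.update_self] at ht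

end GenericRegularityK11

/-- **Registered helper `k11_linForm_regular` (siege k11, toward stub `CycleAPIAt3`)**: in `T[u]`,
the linear form `∑ᵤ Xᵤ · cᵤ` is a non-zero-divisor as soon as a combination `∑ nᵤ cᵤ` with
`n_{u₀} = 1` is a non-zero-divisor of `T`. [folklore] -/
theorem k11_linForm_regular :
    ∀ {T : Type} [CommRing T] {U : Type} [Fintype U] (c n : U → T) (u₀ : U), n u₀ = 1 →
      (∀ t : T, (∑ u, n u * c u) * t = 0 → t = 0) →
      ∀ F : MvPolynomial U T, (∑ u, MvPolynomial.X u * MvPolynomial.C (c u)) * F = 0 → F = 0 :=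
  fun c n u₀ hn hreg _ hF => GenericRegularityK11.linForm_mul_eq_zero_of_combination c n u₀ hn hreg hF

end Summit.Schanuel.Schanuel.Cruxes.ApproximationProperty.OrbitInterpolationDeterminant

end
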